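import Summits.Parity.GeneralizedHardyLittlewood.Theorems.LeeYangFibresAbsoluteUpgradeClipCells
import Summits.Parity.GeneralizedHardyLittlewood.Theorems.LeeYangFibresAbsoluteUpgradeSinglesDecay
import Summits.Parity.GeneralizedHardyLittlewood.Theorems.LeeYangFibresAbsoluteUpgradeWalshClipping
import Summits.Parity.GeneralizedHardyLittlewood.Theorems.LeeYangFibresAbsoluteUpgradeRoughAnatomy
import Summits.Parity.GeneralizedHardyLittlewood.Theorems.LeeYangFibresAbsoluteUpgradeCellsToDimOne
import Summits.Parity.GeneralizedHardyLittlewood.Theorems.LeeYangFibresRelativeDimOne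
import HarnessLib

/-!
# Route `LeeYangFibres`, crux `AbsoluteUpgrade` (stmt-Parity-14116), line `nlc-cells-absolute-clip`:
# the reduction — the crux from the two cell hypotheses

The line `nlc-cells-absolute-clip` (skeleton `Cruxes/AbsoluteUpgrade/Lines/nlc_cells_absolute_clip.lean`)
reduces the crux `AbsoluteUpgrade : RelativeDimOne → DimOne` to two conjectural statements about the
joint rough `Ω`-cells of a one-dimensional system along slowly divergent roughness
`u ≤ A log log log N` (both defined in `Theorems/LeeYangFibresAbsoluteUpgradeDefs.lean`):

* `CellParityLawLog3` — the route's cell parity law (crux 3) uniformly along the slow range;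
* `CellNLC` — the negative lattice condition on the prime corner `{1,2,3}^t` with mass-scaled slack
  (the line's non-sieve input, HL-strength).

With every provable stub of the line now LANDED (`stub_walshClipping` p97202, `stub_roughAnatomy`
p97352, `stub_cellsToDimOne` p100021, `stub_clipCells` p117105, `stub_singlesDecay`), this file records
the kernel-checked reduction as theorems of the tree:

* `primeCellsAbsolute_of_nlcInputs : CellParityLawLog3 → CellNLC → PrimeCellsAbsolute`,
* `dimOne_of_nlcInputs : CellParityLawLog3 → CellNLC → DimOne` — NO guard is needed: the two cell
  hypotheses give the absolute `d = 1` Dickson–Hardy–Littlewood statement outright,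
* `absoluteUpgrade_of_inputs` (registered sub-goal of the skeleton, verbatim):
  `(RelativeDimOne → CellParityLawLog3) → (RelativeDimOne → CellNLC) → AbsoluteUpgrade`,
* `relativeDimOne_of_nlcInputs` : the two cell hypotheses also give `RelativeDimOne`
  (through `DimOne → RelativeDimOne`, tree `relativeDimOne_of_dimOne`), so the guarded and unguarded
  forms of the line's inputs are equivalent in strength up to `RelativeDimOne` itself.

Nothing here is conjectural: the hypotheses are explicit.  What remains OPEN for the crux is exactly
the pair `CellParityLawLog3`, `CellNLC` (promote-stub candidates).

References: Green–Tao 2010, Conj. 1.2/1.4 [GreenTao2010]; Borcea–Brändén 2009 [BorceaBranden2009]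
(negative dependence pedigree of `CellNLC`); Friedlander–Iwaniec, Opera de Cribro [FriedlanderIwaniecOpera2010].
-/

noncomputable section

namespace Summit.Parity.GeneralizedHardyLittlewood.Theorems.AbsoluteUpgrade

open Summit.Parity.GeneralizedHardyLittlewood.Cruxes.AbsoluteUpgrade.NlcCellsAbsoluteClip
open Summit.Parity.GeneralizedHardyLittlewood.Theses.LeeYangFibres

/-- **Absolute prime cells from the two cell hypotheses.** The clipping assembly `stub_clipCells` fed
with the landed `stub_singlesDecay`, `stub_walshClipping`, `stub_roughAnatomy`. [folklore] -/
theorem primeCellsAbsolute_of_nlcInputs (hlaw : CellParityLawLog3) (hnlc : CellNLC) :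
    PrimeCellsAbsolute :=
  stub_clipCells hlaw hnlc stub_singlesDecay stub_walshClipping stub_roughAnatomy

/-- **`DimOne` from the two cell hypotheses** (unguarded): absolute prime cells and partial summation
(`stub_cellsToDimOne`). [cite: GreenTao2010, Conj. 1.2] -/
theorem dimOne_of_nlcInputs (hlaw : CellParityLawLog3) (hnlc : CellNLC) : DimOne :=
  stub_cellsToDimOne (primeCellsAbsolute_of_nlcInputs hlaw hnlc)

/-- **The crux from the two GUARDED cell hypotheses** (registered sub-goal `absoluteUpgrade_of_inputs`
of the skeleton `Lines/nlc_cells_absolute_clip.lean`, verbatim): `RelativeDimOne` unlocks the two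
inputs, and `dimOne_of_nlcInputs` concludes. [folklore] -/
theorem absoluteUpgrade_of_inputs : (RelativeDimOne → CellParityLawLog3) → (RelativeDimOne → CellNLC) → AbsoluteUpgrade :=
  fun hL hN hR => dimOne_of_nlcInputs (hL hR) (hN hR)

/-- The two cell hypotheses imply `RelativeDimOne` as well (`DimOne → RelativeDimOne`,
`relativeDimOne_of_dimOne`), so guarding them by `RelativeDimOne` costs nothing in strength.
[cite: GreenTao2010, Conj. 1.4] -/
theorem relativeDimOne_of_nlcInputs (hlaw : CellParityLawLog3) (hnlc : CellNLC) : RelativeDimOne :=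
  Summit.Parity.GeneralizedHardyLittlewood.Theorems.LeeYangFibresRelativeDimOne.relativeDimOne_of_dimOne
    (dimOne_of_nlcInputs hlaw hnlc)

end Summit.Parity.GeneralizedHardyLittlewood.Theorems.AbsoluteUpgrade

end
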